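import Mathlib
import Literature.Analysis.FluidPDE.HardSphereCollisionRecord
import Literature.MathematicalPhysics.KineticTheory.HardSphereEuler
import Literature.MathematicalPhysics.KineticTheory.HardSphereEulerProofs
import Summits.AtomisticToContinuum.HydrodynamicLimit.Theorems.OneFlightGossipEngineOneFlightLayeredChaosRegimes
import HarnessLib

/-!
# `OneFlightGossipEngine.OneFlightLayeredChaos` — the TRANSLATION QUASI-INVARIANCE frame of the disc form
(crux stmt-AtomisticToContinuum-14535, line `Sketch`, lead cycle c3; TransQuasiInv layer 1/3; registered stub
`transQuasiInv_entry`)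

The typed hypothesis one level below the line's DISC-FORM frame (`…DiscRegimes.lean`: `OLC.RegimeDiscTail/Body`,
event-level disc-uniformity, given the coarse past, of the transverse offset `b` of the colliding pair at the later
flight start).  Disc-uniformity is bookkeeping once the joint law of `(ĝ, b)` on `W ∩ (X ∩ E)` is quasi-invariant
under translations of `b` inside the unit disc of `ĝ^⊥` (the brick `disc_flat_bundle_of_quasiInvariant`,
`…DiscFlatBundle.lean`, fibrewise in `ĝ`, integrated over `𝒢`); this file states that quasi-invariance as a regime
frame of exactly the shape of `OLC.RegimeDiscTail/Body`:

* `OLC.RegimeTransQuasiInvTail θ₀ σ bound X` — VERBATIM the lets `G ε w q P W gIn sPlus bOff` of `OLC.RegimeDiscTail`,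
  plus `D g = {u | ⟪u, g⟫ = 0, ‖u‖ < 1}` (the OPEN unit disc of `g^⊥`) and `pr g δ = δ − ⟪δ, g⟫ g` (transverse part of a
  shift `δ ∈ ℝ³`; shifts are taken in `ℝ³` and projected, so no frame of `ĝ^⊥` is needed), asserting for every shift
  `δ`, every measurable `S ⊆ ℝ³ × ℝ³` and every event `E ∈ 𝒢 = comap (coarsePastOf q i n, nthPartnerOf i n)`:
  `|P(W ∩ {(ĝ, b) ∈ S, b ∈ D_ĝ, b − pr ĝ δ ∈ D_ĝ} ∩ (X ∩ E)) − P(W ∩ {(ĝ, b + pr ĝ δ) ∈ S, b + pr ĝ δ ∈ D_ĝ, b ∈ D_ĝ} ∩ (X ∩ E))|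
   ≤ bound`
  (both events are empty unless `‖pr ĝ δ‖ < 2`: only transverse shifts up to the disc diameter matter).
* `OLC.RegimeTransQuasiInvBody θ₀ X := ∃ C p σ₀ > 0, ∀ σ ∈ (0, σ₀), RegimeTransQuasiInvTail θ₀ σ (C σ^p) X`.
* `transQuasiInv_entry` (registered): the tail is monotone in the bound (the frame's trivial API).

These are typed HYPOTHESIS frames of the line (the research content of the short-gap stub), not published facts; the
transfer `RegimeTransQuasiInvBody θ₀ X → RegimeDiscBody θ₀ X` is `…TransQuasiInvTransfer.lean`.
-/

open scoped BigOperators ENNReal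
open MeasureTheory Set
open Literature.Analysis.FluidPDE Literature.MathematicalPhysics.KineticTheory

namespace Summit.AtomisticToContinuum.HydrodynamicLimit.Theorems.OLC

noncomputable section

/-- The TRANSLATION QUASI-INVARIANCE tail of the crux on the regime `X` (activity `1`, temperature `θ₀`, mesh
`ρ⋆(σ)`): with the lets of the disc-form tail `OLC.RegimeDiscTail` verbatim (`b(z) = ε⁻¹ (q − ⟪q, ĝ⟫ ĝ)`,
`q = sepVec (x_i(s⁺)) (x_j(s⁺))`, `s⁺ = max(s_i, s_j)` the later flight start, positions of the flow at time `s⁺`),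
`D g = {u | ⟪u, g⟫ = 0, ‖u‖ < 1}` the open unit disc of `g^⊥` and `pr g δ = δ − ⟪δ, g⟫ g` the transverse part of a shift:
`∀ τ > 0 ∀ n ∃ N₀ ∀ N ≥ N₀ ∀ Φ i, ∀ δ ∈ ℝ³, ∀ S ⊆ ℝ³ × ℝ³ measurable, ∀ E ∈ 𝒢,
|P(W ∩ {(ĝ, b) ∈ S, b ∈ D ĝ, b − pr ĝ δ ∈ D ĝ} ∩ (X ∩ E)) − P(W ∩ {(ĝ, b + pr ĝ δ) ∈ S, b + pr ĝ δ ∈ D ĝ, b ∈ D ĝ} ∩ (X ∩ E))|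
 ≤ bound` — the joint law of `(ĝ, b)` on `W ∩ (X ∩ E)` is invariant, up to `bound` in total variation, under every
translation of `b` inside the disc (typed HYPOTHESIS frame of the line, not a published fact). [folklore] -/
def RegimeTransQuasiInvTail (θ₀ σ bound : ℝ) (X : Regime) : Prop :=
  ∀ τ : ℝ, 0 < τ → ∀ n : ℕ, ∃ N₀ : ℕ, ∀ N : ℕ, N₀ ≤ N →
    ∀ Φ : HardSphereFlow (Torus.geometry (Fin 3)) (hsDiameter σ N) (N + 1),
    ∀ (i : Fin (N + 1)) (δ : V3) (S : Set (V3 × V3)), MeasurableSet S →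
    let G : Geometry (Fin 3) T3 := Torus.geometry (Fin 3)
    let ε : ℝ := hsDiameter σ N
    let w : ℝ := τ * ((N + 1 : ℕ) : ℝ) ^ (-(1 / 3 : ℝ))
    let q : T3 → (Fin 3 → ℤ) := Torus.coarseCell (rhoStar σ * ((N + 1 : ℕ) : ℝ) ^ (-(1 / 3 : ℝ)))
    let P : Measure (Config (N + 1) (Fin 3) T3) := localGibbsLaw σ (fun _ => 1) (fun _ => 0) (fun _ => θ₀) N Φ
    let W : Set (Config (N + 1) (Fin 3) T3) :=
      {z | n + 1 ≤ Set.ncard (collisionTimesOf G ε (fun t => Φ.flow t z) i ∩ Set.Ioc 0 w)}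
    let gIn : Config (N + 1) (Fin 3) T3 → V3 := fun z =>
      ‖((Φ.coarsePastOf q i n z).1 i).2 - ((Φ.coarsePastOf q i n z).2 (Φ.nthPartnerOf i n z)).2‖⁻¹ •
        (((Φ.coarsePastOf q i n z).1 i).2 - ((Φ.coarsePastOf q i n z).2 (Φ.nthPartnerOf i n z)).2)
    let sPlus : Config (N + 1) (Fin 3) T3 → ℝ := fun z =>
      max (flightStart G ε (fun t => Φ.flow t z) 0 i (Φ.nthCollisionTimeOf i n z))
        (flightStart G ε (fun t => Φ.flow t z) 0 (Φ.nthPartnerOf i n z) (Φ.nthCollisionTimeOf i n z))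
    let bOff : Config (N + 1) (Fin 3) T3 → V3 := fun z =>
      ε⁻¹ • (G.sepVec (Φ.flow (sPlus z) z i).1 (Φ.flow (sPlus z) z (Φ.nthPartnerOf i n z)).1 -
        inner ℝ (G.sepVec (Φ.flow (sPlus z) z i).1 (Φ.flow (sPlus z) z (Φ.nthPartnerOf i n z)).1) (gIn z) •
          gIn z)
    let D : V3 → Set V3 := fun g => {u | inner ℝ u g = 0 ∧ ‖u‖ < 1}
    let pr : V3 → V3 → V3 := fun g δ' => δ' - inner ℝ δ' g • g
    ∀ E : Set (Config (N + 1) (Fin 3) T3),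
      MeasurableSet[MeasurableSpace.comap (fun z => (Φ.coarsePastOf q i n z, Φ.nthPartnerOf i n z))
        inferInstance] E →
      |(P (W ∩ {z | (gIn z, bOff z) ∈ S ∧ bOff z ∈ D (gIn z) ∧ bOff z - pr (gIn z) δ ∈ D (gIn z)} ∩
            (X σ n N Φ i ∩ E))).toReal -
          (P (W ∩ {z | (gIn z, bOff z + pr (gIn z) δ) ∈ S ∧ bOff z + pr (gIn z) δ ∈ D (gIn z) ∧ bOff z ∈ D (gIn z)} ∩
            (X σ n N Φ i ∩ E))).toReal| ≤ bound

/-- The TRANSLATION QUASI-INVARIANCE body of the crux on the regime `X`: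
`∃ C p σ₀ > 0, ∀ σ ∈ (0, σ₀), RegimeTransQuasiInvTail θ₀ σ (C σ^p) X` — "given the coarse past, on `X`, the joint law of
the incoming direction proxy and of the transverse offset of the colliding pair at the later flight start is invariant
under translations of the offset inside the unit disc of `ĝ^⊥`, up to `C σ^p` in `L¹(𝒢)`, uniformly in `n, τ`, for
`N ≥ N₀(σ, τ, n)`" (typed HYPOTHESIS frame of the line, not a published fact; it implies the disc form
`RegimeDiscBody θ₀ X`, file `…TransQuasiInvTransfer.lean`). [folklore] -/
def RegimeTransQuasiInvBody (θ₀ : ℝ) (X : Regime) : Prop :=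
  ∃ C : ℝ, 0 < C ∧ ∃ p : ℝ, 0 < p ∧ ∃ σ₀ : ℝ, 0 < σ₀ ∧ ∀ σ : ℝ, 0 < σ → σ < σ₀ →
    RegimeTransQuasiInvTail θ₀ σ (C * σ ^ p) X

/-! ## Trivial API of the frame -/

/-- **The translation quasi-invariance tail is monotone in the bound** (registered stub `transQuasiInv_entry` of crux
stmt-AtomisticToContinuum-14535, line `Sketch`; the frame's entry point). [folklore] -/
theorem transQuasiInv_entry : ∀ {θ₀ σ bound bound' : ℝ} (X : Summit.AtomisticToContinuum.HydrodynamicLimit.Theorems.OLC.Regime), bound ≤ bound' → Summit.AtomisticToContinuum.HydrodynamicLimit.Theorems.OLC.RegimeTransQuasiInvTail θ₀ σ bound X → Summit.AtomisticToContinuum.HydrodynamicLimit.Theorems.OLC.RegimeTransQuasiInvTail θ₀ σ bound' X := by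
  intro θ₀ σ bound bound' X hle h τ hτ n
  obtain ⟨N₀, hN₀⟩ := h τ hτ n
  refine ⟨N₀, fun N hN Φ i δ S hS => ?_⟩
  intro G ε w q P W gIn sPlus bOff D pr E hE
  exact (hN₀ N hN Φ i δ S hS E hE).trans hle

/-- The body is monotone in the regime's constant: a body with constant `C` is a body with any larger constant. [folklore] -/
theorem regimeTransQuasiInvBody_of_tail {θ₀ : ℝ} {X : Regime} {C p σ₀ : ℝ} (hC : 0 < C) (hp : 0 < p) (hσ₀ : 0 < σ₀)
    (h : ∀ σ : ℝ, 0 < σ → σ < σ₀ → RegimeTransQuasiInvTail θ₀ σ (C * σ ^ p) X) : RegimeTransQuasiInvBody θ₀ X :=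
  ⟨C, hC, p, hp, σ₀, hσ₀, h⟩

end

end Summit.AtomisticToContinuum.HydrodynamicLimit.Theorems.OLC
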